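import Mathlib
import Summits.Ventures.PercRepro.TriangleCapOneTriangleNineA

/-!
# PercRepro — THE ONE-TRIANGLE CASE WITHOUT AN OUTER VERTEX AT THE CELL `(9, 16)` (p3, gen 37; part 70)

`S = {u, v, w}` the only triangle, every vertex off `S` adjacent to exactly one of `u, v, w` (no outer vertex),
`k = 9`, `m = 16`.  The far count of the vertices OFF `S` is the four-block sum for `Sᶜ` (`sum_far_eq_double D Sᶜ`):
the `S × S` block pays `2 |Sᶜ| = 12`, the two cross blocks pay `|Sᶜ|² − Σ_{x ∈ S} d_x² − Q′` each
(`block_cross D Sᶜ`, `d_x = degIn Sᶜ x` the private degrees, `Q′ = adjPairs D Sᶜ`), while the vertices of `S` receive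
`Q′` from the pairs inside `Sᶜ` (`block_outside D S`); with `2m = 6 + 2|Sᶜ| + Q′`, i.e. `Q′ = 14`, this is
`Σ deficit ≥ 84 − Q′ − 2 Σ d_x² = 70 − 2 Σ d_x²`.  The private sets being independent, `Q′ ≤ Σ_x d_x (|Sᶜ| − d_x)
= 36 − Σ d_x²`, so `Σ d_x² ≤ 22`, hence `≤ 20` for a partition `d_u + d_v + d_w = 6`, and `Σ deficit ≥ 30 = 4k − 6`.

* **`one_triangle_nine_sixteen_no_outer`** — `K₄⁻`-free on `9` vertices with `16` edges, the only triangle `u v w`,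
  no outer vertex ⇒ `Σ_v d(v)² + 12 ≤ 144`.
Axioms: standard.
-/

namespace PercRepro

namespace TriangleCap

namespace C047

open Finset

variable {V : Type*} [Fintype V] [DecidableEq V]

omit [Fintype V] [DecidableEq V] in
/-- A partition `a + b + c = 6` with `14 ≤ Σ a (6 − a)` has `Σ a² ≤ 20`. -/
theorem partition_sq_le_twenty (a b c : ℕ) (h : a + (b + c) = 6)
    (h2 : 14 ≤ a * (6 - a) + (b * (6 - b) + c * (6 - c))) : a * a + (b * b + c * c) ≤ 20 := by
  have hc' : c = 6 - a - b := by omega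
  subst hc'
  have h1 : a ≤ 6 := by omega
  have h2' : b ≤ 6 := by omega
  interval_cases a <;> interval_cases b <;> omega

omit [Fintype V] [DecidableEq V] in
/-- The linear assembly of the cell `(9, 16)`. -/
theorem nine_sixteen_arith {X F1 F2 T B1 B2 B3 B4 C1 C2 C3 C4 Q' sq : ℕ}
    (hid : 2 * X + (F1 + F2) = 2 * 16 * 9 + T) (hT : T ≤ 6) (hfarR : F2 = B1 + B2 + (B3 + B4))
    (hSS : 6 * 6 ≤ B4 + 2 * 12) (hcross : 6 * 6 ≤ B2 + Q' + sq) (hswap : B3 = B2)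
    (hfarS : F1 = C1 + C2 + (C3 + C4)) (hout : 3 * Q' ≤ C4 + 2 * Q') (hQ : Q' = 14) (hsq : sq ≤ 20) :
    X + 2 * (9 - 3) ≤ 16 * 9 := by
  omega

/-- **THE CELL `(9, 16)`, ONE TRIANGLE, NO OUTER VERTEX.** -/
theorem one_triangle_nine_sixteen_no_outer (D : SimpleGraph V) [DecidableRel D.Adj] (hK : K4mFree D)
    (hk : Fintype.card V = 9) (hm : D.edgeFinset.card = 16) {u v w : V}
    (huv : D.Adj u v) (huw : D.Adj u w) (hvw : D.Adj v w)
    (hT : ∀ a b c, D.Adj a b → D.Adj a c → D.Adj b c → a = u ∨ a = v ∨ a = w)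
    (hq : ∀ z, z ∉ ({u, v, w} : Finset V) → 1 ≤ degIn D {u, v, w} z) :
    ∑ v, deg D v * deg D v + 2 * (Fintype.card V - 3) ≤ D.edgeFinset.card * Fintype.card V := by
  set S : Finset V := {u, v, w} with hS
  have h3 : S.card = 3 := card_triple huv.ne huw.ne hvw.ne
  have hcl := clique_triple D huv huw hvw
  have hRcard : Sᶜ.card = 6 := by rw [card_compl, h3, hk]
  have hQ : adjPairs D S = 6 := by
    rw [adjPairs_eq_sum_degIn, sum_congr rfl (fun x hx => degIn_self_of_clique D h3 hcl hx), sum_const, h3,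
      smul_eq_mul]
  -- every vertex off `S` has exactly one neighbour in `S`
  have hs1 : ∀ z ∈ Sᶜ, degIn D S z = 1 := by
    intro z hz
    have h1 : degIn D S z ≤ 1 := degIn_le_one_of_triangle D hK huv huw hvw (mem_compl.mp hz)
    have h2 : 1 ≤ degIn D S z := hq z (mem_compl.mp hz)
    omega
  have hsum1 : ∑ z ∈ Sᶜ, degIn D S z = 6 := by
    rw [sum_congr rfl hs1, sum_const, hRcard, smul_eq_mul]
  have hcomm := sum_degIn_comm D S Sᶜ
  rw [hsum1] at hcomm
  -- `Q′ = 14`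
  have hdens := two_mul_card_edges_eq_adjPairs_add D S
  rw [hQ, hsum1, hm] at hdens
  set Q' := ∑ z ∈ Sᶜ, degIn D Sᶜ z with hQ'
  have hQ'14 : Q' = 14 := by omega
  -- `Σ_{x ∈ S} W′(x) = Q′`
  have hW' : ∑ x ∈ S, ∑ y ∈ Sᶜ.filter (fun y => D.Adj x y), degIn D Sᶜ y = Q' := by
    rw [hQ']
    have := double_sum_ite_swap D Sᶜ S (fun y _ => degIn D Sᶜ y)
    rw [double_sum_ite_left] at this
    rw [← this]
    exact sum_congr rfl (fun y hy => by rw [hs1 y hy, one_mul])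
  -- the far count of the vertices off `S`: the four blocks for `Sᶜ`
  have hfarR := sum_far_eq_double D Sᶜ
  rw [double_sum_split Sᶜ, compl_compl] at hfarR
  have hcross := block_cross D Sᶜ
  rw [compl_compl, hcomm, hW', hRcard] at hcross
  have hswap := block_cross_swap D Sᶜ
  rw [compl_compl] at hswap
  have hSS := block_outside D Sᶜ
  rw [compl_compl, hRcard] at hSS
  have hSSdeg : ∑ x ∈ S, degIn D S x = 6 := by
    rw [sum_congr rfl (fun x hx => degIn_self_of_clique D h3 hcl hx), sum_const, h3, smul_eq_mul]
  have hSSprod : ∑ x ∈ S, degIn D Sᶜ x * degIn D S x = 12 := by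
    have e : ∀ x ∈ S, degIn D Sᶜ x * degIn D S x = degIn D Sᶜ x * 2 := fun x hx => by
      rw [degIn_self_of_clique D h3 hcl hx]
    calc ∑ x ∈ S, degIn D Sᶜ x * degIn D S x = (∑ x ∈ S, degIn D Sᶜ x) * 2 := by
          rw [sum_congr rfl e, sum_mul]
      _ = 12 := by rw [hcomm]
  rw [hSSdeg, hSSprod] at hSS
  -- the far count of the vertices of `S`: the block `Sᶜ × Sᶜ`
  have hfarS := sum_far_eq_double D S
  rw [double_sum_split S] at hfarS
  have hout := block_outside D S
  rw [h3] at hout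
  have hsd : ∑ z ∈ Sᶜ, degIn D S z * degIn D Sᶜ z = Q' := by
    rw [hQ']
    exact sum_congr rfl (fun z hz => by rw [hs1 z hz, one_mul])
  rw [hsd] at hout
  -- the private sets are independent: `Q′ ≤ Σ_x d_x (6 − d_x)`
  have hpriv : ∀ x ∈ S, ∀ y ∈ Sᶜ, D.Adj x y → degIn D Sᶜ y + degIn D Sᶜ x ≤ 6 := by
    intro x hx y hy hxy
    have hdisj : Disjoint (Sᶜ.filter (fun t => D.Adj y t)) (Sᶜ.filter (fun t => D.Adj x t)) := by
      rw [disjoint_left]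
      intro t ht1 ht2
      rw [mem_filter] at ht1 ht2
      have htri := hT y x t hxy.symm ht1.2 ht2.2
      rw [mem_compl, hS] at hy
      simp only [mem_insert, mem_singleton] at hy
      exact hy htri
    have := card_le_card (union_subset (filter_subset _ _) (filter_subset _ _) :
      Sᶜ.filter (fun t => D.Adj y t) ∪ Sᶜ.filter (fun t => D.Adj x t) ⊆ Sᶜ)
    rw [card_union_of_disjoint hdisj, hRcard] at this
    exact this
  have hQ'le : Q' ≤ ∑ x ∈ S, degIn D Sᶜ x * (6 - degIn D Sᶜ x) := by
    rw [hQ']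
    have e1 : ∑ y ∈ Sᶜ, degIn D Sᶜ y = ∑ x ∈ S, ∑ y ∈ Sᶜ, if D.Adj x y then degIn D Sᶜ y else 0 := by
      rw [double_sum_ite_right]
      exact sum_congr rfl (fun y hy => by rw [hs1 y hy, one_mul])
    rw [e1]
    calc ∑ x ∈ S, ∑ y ∈ Sᶜ, (if D.Adj x y then degIn D Sᶜ y else 0) ≤
        ∑ x ∈ S, ∑ y ∈ Sᶜ, (if D.Adj x y then 6 - degIn D Sᶜ x else 0) := by
          apply sum_le_sum
          intro x hx
          apply sum_le_sum
          intro y hy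
          by_cases hxy : D.Adj x y
          · simp only [hxy, if_true]
            have := hpriv x hx y hy hxy
            omega
          · simp [hxy]
      _ = ∑ x ∈ S, degIn D Sᶜ x * (6 - degIn D Sᶜ x) := double_sum_ite_left D S Sᶜ _
  -- the private degrees `a, b, c` with `a + b + c = 6`
  have huvw : u ∉ ({v, w} : Finset V) := by
    simp only [mem_insert, mem_singleton, not_or]; exact ⟨huv.ne, huw.ne⟩
  have hvw' : v ∉ ({w} : Finset V) := by simp only [mem_singleton]; exact hvw.ne
  have e_sum : ∑ x ∈ S, degIn D Sᶜ x = degIn D Sᶜ u + (degIn D Sᶜ v + degIn D Sᶜ w) := by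
    rw [hS, sum_insert huvw, sum_insert hvw', sum_singleton]
  have e_sq : ∑ x ∈ S, degIn D Sᶜ x * degIn D Sᶜ x =
      degIn D Sᶜ u * degIn D Sᶜ u + (degIn D Sᶜ v * degIn D Sᶜ v + degIn D Sᶜ w * degIn D Sᶜ w) := by
    rw [hS, sum_insert huvw, sum_insert hvw', sum_singleton]
  have e_prod : ∑ x ∈ S, degIn D Sᶜ x * (6 - degIn D Sᶜ x) = degIn D Sᶜ u * (6 - degIn D Sᶜ u) +
      (degIn D Sᶜ v * (6 - degIn D Sᶜ v) + degIn D Sᶜ w * (6 - degIn D Sᶜ w)) := by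
    rw [hS, sum_insert huvw, sum_insert hvw', sum_singleton]
  rw [e_sum] at hcomm
  rw [e_sq] at hcross
  rw [e_prod] at hQ'le
  -- assemble: `Σ deficit ≥ 84 − Q′ − 2 Σ d_x²`, and `Σ d_x² ≤ 20`
  have hid := two_mul_sum_deg_sq_add_sum_deficit D
  have h6 := card_triangles3_le_six D hT
  rw [sum_deficit_eq_sum_far, ← sum_add_sum_compl S (far D), hk, hm] at hid
  have hsq := partition_sq_le_twenty (degIn D Sᶜ u) (degIn D Sᶜ v) (degIn D Sᶜ w) hcomm (by omega)
  rw [hk, hm]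
  exact nine_sixteen_arith hid h6 hfarR hSS hcross hswap hfarS hout hQ'14 hsq

end C047

end TriangleCap

end PercRepro
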